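import Summits.Ventures.PercRepro.C041TriDomMonotoneInjection
import Summits.Ventures.PercRepro.C041TriDomExcessConvMain

/-!
# ROW C-041 — EACH CROSSED CLASS IS DOMINATED
(p6, gen 44; P6-TWOEXIT-LEAN.md §53 ADDENDUM 15, part I of II)

**THEOREM (EACH CROSSED CLASS IS DOMINATED)** (`class12_le_topBot`, `class23_le_topBot`, `class31_le_topBot`):
on EVERY finite three-marked host and every up-set `V` of colourings, each of the three cyclic crossed classes
`(s₁,s₂)`, `(s₂,s₃)`, `(s₃,s₁)` meets `V` at most as often as `(⊤,⊥)` does.  PROOF: `(s₁,s₂)` lies in the up-set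
`W = {x ~_R y, x ≁_B y, y ≁_B z}` intersected with `{x ~_B z, x ≁_R z}`, while `(⊤,⊥) = W ∩ {x ~_R z, x ≁_B z}`;
THEOREM (TWO-MARK DOMINATION), exclusive form (`count_blue_only_le_count_red_only`), at the up-set `V ∩ W` does
the rest (`class_le_of_shape`) — red connectivity is monotone and blue connectivity antitone in the colouring
(`RdS_mono`, `MgS_anti`); the patterns are read as connectivities by `rsig_eq_iff` / `bsig_eq_iff`.
CONJECTURE (STOCHASTIC DOMINATION) asks that the three red-ward injections can be made DISJOINT; part II
(`C041TriDomDominationSeparable`) proves it on the separable hosts, where two of the classes are empty.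
-/

namespace PercRepro

namespace ZoneZ

namespace MultiExit

open ZoneData Finset

variable {V₁ E₁ U₁ U₂ : Type} (Z₁ : ZoneData V₁ E₁ U₁ U₂) (u u' a₁ : V₁)

/-! ## Monotonicity of the connectivities in the colouring -/

/-- Red connectivity of the all-free status is monotone in the colouring. -/
theorem RdS_mono {ω ω' : E₁ → Bool} (h : LeCol ω ω') {k v : V₁} (hr : RdS Z₁ (fun _ => EStat.free) ω k v) :
    RdS Z₁ (fun _ => EStat.free) ω' k v := by
  unfold RdS at hr ⊢
  refine reach_mono (fun x y hxy => ?_) hr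
  obtain ⟨e, hj, he⟩ := hxy
  refine ⟨e, hj, ?_⟩
  unfold redE at he ⊢
  rcases he with he | ⟨_, he⟩
  · exact absurd he (fun h => EStat.noConfusion h)
  · exact Or.inr ⟨rfl, h e he⟩

/-- Blue connectivity of the all-free status is antitone in the colouring. -/
theorem MgS_anti {ω ω' : E₁ → Bool} (h : LeCol ω ω') {k v : V₁} (hb : MgS Z₁ (fun _ => EStat.free) ω' k v) :
    MgS Z₁ (fun _ => EStat.free) ω k v := by
  unfold MgS at hb ⊢
  refine reach_mono (fun x y hxy => ?_) hb
  obtain ⟨e, hj, he⟩ := hxy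
  refine ⟨e, hj, ?_⟩
  unfold blueE at he ⊢
  rcases he with he | ⟨_, he⟩
  · exact absurd he (fun h => EStat.noConfusion h)
  · refine Or.inr ⟨rfl, ?_⟩
    by_contra hc
    have : ω e = true := by simpa using hc
    rw [h e this] at he
    exact Bool.noConfusion he

/-- Red connectivity composes (all-free status). -/
theorem RdS_trans' {ω : E₁ → Bool} {k x v : V₁} (h1 : RdS Z₁ (fun _ => EStat.free) ω k x)
    (h2 : RdS Z₁ (fun _ => EStat.free) ω x v) : RdS Z₁ (fun _ => EStat.free) ω k v :=
  reach_trans' h1 h2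

/-- Red connectivity through a common vertex (all-free status). -/
theorem RdS_trans_of_symm' {ω : E₁ → Bool} {k x v : V₁} (h1 : RdS Z₁ (fun _ => EStat.free) ω k x)
    (h2 : RdS Z₁ (fun _ => EStat.free) ω k v) : RdS Z₁ (fun _ => EStat.free) ω x v :=
  reach_trans_of_symm (RAdjS_symm Z₁ _ ω) h1 h2

/-- Blue connectivity is symmetric (all-free status). -/
theorem MgS_symm' {ω : E₁ → Bool} {k v : V₁} (h : MgS Z₁ (fun _ => EStat.free) ω k v) :
    MgS Z₁ (fun _ => EStat.free) ω v k :=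
  reach_trans_of_symm (BAdjS_symm Z₁ _ ω) h (mem_reach_self _ _)

/-- Red connectivity is symmetric (all-free status). -/
theorem RdS_symm' {ω : E₁ → Bool} {k v : V₁} (h : RdS Z₁ (fun _ => EStat.free) ω k v) :
    RdS Z₁ (fun _ => EStat.free) ω v k :=
  reach_trans_of_symm (RAdjS_symm Z₁ _ ω) h (mem_reach_self _ _)

/-- Blue connectivity composes (all-free status). -/
theorem MgS_trans' {ω : E₁ → Bool} {k x v : V₁} (h1 : MgS Z₁ (fun _ => EStat.free) ω k x)
    (h2 : MgS Z₁ (fun _ => EStat.free) ω x v) : MgS Z₁ (fun _ => EStat.free) ω k v :=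
  reach_trans' h1 h2

/-! ## The patterns as connectivities -/

open Classical in
/-- A red pattern equals a Boolean triple iff the three connectivities decide to it. -/
theorem rsig_eq_iff (ω : E₁ → Bool) (b₁ b₂ b₃ : Bool) :
    rsig Z₁ u u' a₁ (fun _ => EStat.free) ω = (b₁, b₂, b₃) ↔
      (RdS Z₁ (fun _ => EStat.free) ω a₁ u ↔ b₁ = true) ∧ (RdS Z₁ (fun _ => EStat.free) ω a₁ u' ↔ b₂ = true) ∧
        (RdS Z₁ (fun _ => EStat.free) ω u u' ↔ b₃ = true) := by
  unfold rsig
  simp only [Prod.mk.injEq]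
  constructor
  · rintro ⟨h1, h2, h3⟩
    refine ⟨?_, ?_, ?_⟩
    · rw [← h1]; exact (decide_eq_true_iff).symm
    · rw [← h2]; exact (decide_eq_true_iff).symm
    · rw [← h3]; exact (decide_eq_true_iff).symm
  · rintro ⟨h1, h2, h3⟩
    refine ⟨?_, ?_, ?_⟩
    · exact decide_eq_of_iff h1
    · exact decide_eq_of_iff h2
    · exact decide_eq_of_iff h3

open Classical in
/-- A blue pattern equals a Boolean triple iff the three connectivities decide to it. -/
theorem bsig_eq_iff (ω : E₁ → Bool) (b₁ b₂ b₃ : Bool) :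
    bsig Z₁ u u' a₁ (fun _ => EStat.free) ω = (b₁, b₂, b₃) ↔
      (MgS Z₁ (fun _ => EStat.free) ω a₁ u ↔ b₁ = true) ∧ (MgS Z₁ (fun _ => EStat.free) ω a₁ u' ↔ b₂ = true) ∧
        (MgS Z₁ (fun _ => EStat.free) ω u u' ↔ b₃ = true) := by
  unfold bsig
  simp only [Prod.mk.injEq]
  constructor
  · rintro ⟨h1, h2, h3⟩
    refine ⟨?_, ?_, ?_⟩
    · rw [← h1]; exact (decide_eq_true_iff).symm
    · rw [← h2]; exact (decide_eq_true_iff).symm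
    · rw [← h3]; exact (decide_eq_true_iff).symm
  · rintro ⟨h1, h2, h3⟩
    refine ⟨?_, ?_, ?_⟩
    · exact decide_eq_of_iff h1
    · exact decide_eq_of_iff h2
    · exact decide_eq_of_iff h3

variable [Fintype E₁] [DecidableEq E₁]

/-! ## Each crossed class is dominated -/

open Classical in
/-- The generic step: a crossed class inside an up-set `W ∩ {p ~_B q, p ≁_R q}` whose `(⊤,⊥)` is
`W ∩ {p ~_R q, p ≁_B q}` is dominated on every up-set. -/
theorem class_le_of_shape (p q : V₁) (C : (E₁ → Bool) → Prop) (W : (E₁ → Bool) → Prop) (hW : UpSet W)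
    (hC : ∀ ω, C ω → W ω ∧ Z₁.Mg p q ω ∧ ¬ Z₁.Rd p q ω)
    (hT : ∀ ω, W ω → Z₁.Rd p q ω → ¬ Z₁.Mg p q ω → TopBot Z₁ a₁ u u' ω)
    {V : (E₁ → Bool) → Prop} (hV : UpSet V) :
    (univ.filter fun ω : E₁ → Bool => V ω ∧ C ω).card ≤
      (univ.filter fun ω : E₁ → Bool => V ω ∧ TopBot Z₁ a₁ u u' ω).card := by
  have hVW : UpSet fun ω : E₁ → Bool => V ω ∧ W ω := fun ω ω' h hle => ⟨hV ω ω' h.1 hle, hW ω ω' h.2 hle⟩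
  have h : (univ.filter fun ω : E₁ → Bool => (V ω ∧ W ω) ∧ Z₁.Mg p q ω ∧ ¬ Z₁.Rd p q ω).card ≤
      (univ.filter fun ω : E₁ → Bool => (V ω ∧ W ω) ∧ Z₁.Rd p q ω ∧ ¬ Z₁.Mg p q ω).card := by
    convert count_blue_only_le_count_red_only Z₁ p q hVW
  refine le_trans (Finset.card_le_card fun ω hω => ?_) (le_trans h (Finset.card_le_card fun ω hω => ?_))
  · rw [Finset.mem_filter] at hω ⊢
    obtain ⟨hu, hVω, hCω⟩ := hω
    obtain ⟨hWω, hM, hR⟩ := hC ω hCω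
    exact ⟨hu, ⟨hVω, hWω⟩, hM, hR⟩
  · rw [Finset.mem_filter] at hω ⊢
    obtain ⟨hu, ⟨hVω, hWω⟩, hR, hM⟩ := hω
    exact ⟨hu, hVω, hT ω hWω hR hM⟩

open Classical in
/-- **THE CLASS `(s₁,s₂)` IS DOMINATED**: `#{V ∧ (s₁,s₂)} ≤ #{V ∧ (⊤,⊥)}` on every up-set `V`. -/
theorem class12_le_topBot {V : (E₁ → Bool) → Prop} (hV : UpSet V) :
    (univ.filter fun ω : E₁ → Bool => V ω ∧ (rsig Z₁ u u' a₁ (fun _ => EStat.free) ω = (true, false, false) ∧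
      bsig Z₁ u u' a₁ (fun _ => EStat.free) ω = (false, true, false))).card ≤
      (univ.filter fun ω : E₁ → Bool => V ω ∧ TopBot Z₁ a₁ u u' ω).card := by
  let W : (E₁ → Bool) → Prop := fun ω => RdS Z₁ (fun _ => EStat.free) ω a₁ u ∧
    ¬ MgS Z₁ (fun _ => EStat.free) ω a₁ u ∧ ¬ MgS Z₁ (fun _ => EStat.free) ω u u'
  have hW : UpSet W := fun ω ω' h hle =>
    ⟨RdS_mono Z₁ hle h.1, fun hb => h.2.1 (MgS_anti Z₁ hle hb), fun hb => h.2.2 (MgS_anti Z₁ hle hb)⟩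
  have hC : ∀ ω, (rsig Z₁ u u' a₁ (fun _ => EStat.free) ω = (true, false, false) ∧
      bsig Z₁ u u' a₁ (fun _ => EStat.free) ω = (false, true, false)) → W ω ∧ Z₁.Mg a₁ u' ω ∧ ¬ Z₁.Rd a₁ u' ω := by
    intro ω ⟨hr, hb⟩
    rw [rsig_eq_iff] at hr
    rw [bsig_eq_iff] at hb
    simp only [iff_true, Bool.false_eq_true, iff_false] at hr hb
    refine ⟨⟨hr.1, hb.1, hb.2.2⟩, ?_, ?_⟩
    · exact (MgS_free Z₁ ω a₁ u').1 hb.2.1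
    · exact fun h => hr.2.1 ((RdS_free Z₁ ω a₁ u').2 h)
  have hT : ∀ ω, W ω → Z₁.Rd a₁ u' ω → ¬ Z₁.Mg a₁ u' ω → TopBot Z₁ a₁ u u' ω := by
    intro ω ⟨h1, h2, h3⟩ hR hM
    unfold TopBot
    rw [rsig_eq_iff, bsig_eq_iff]
    simp only [iff_true, Bool.false_eq_true, iff_false]
    have hR' := (RdS_free Z₁ ω a₁ u').2 hR
    have hM' : ¬ MgS Z₁ (fun _ => EStat.free) ω a₁ u' := fun h => hM ((MgS_free Z₁ ω a₁ u').1 h)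
    exact ⟨⟨h1, hR', RdS_trans_of_symm' Z₁ h1 hR'⟩, h2, hM', h3⟩
  have h := class_le_of_shape Z₁ u u' a₁ a₁ u' _ W hW hC hT hV
  convert h

open Classical in
/-- **THE CLASS `(s₂,s₃)` IS DOMINATED**: `#{V ∧ (s₂,s₃)} ≤ #{V ∧ (⊤,⊥)}` on every up-set `V`. -/
theorem class23_le_topBot {V : (E₁ → Bool) → Prop} (hV : UpSet V) :
    (univ.filter fun ω : E₁ → Bool => V ω ∧ (rsig Z₁ u u' a₁ (fun _ => EStat.free) ω = (false, true, false) ∧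
      bsig Z₁ u u' a₁ (fun _ => EStat.free) ω = (false, false, true))).card ≤
      (univ.filter fun ω : E₁ → Bool => V ω ∧ TopBot Z₁ a₁ u u' ω).card := by
  let W : (E₁ → Bool) → Prop := fun ω => RdS Z₁ (fun _ => EStat.free) ω a₁ u' ∧
    ¬ MgS Z₁ (fun _ => EStat.free) ω a₁ u' ∧ ¬ MgS Z₁ (fun _ => EStat.free) ω a₁ u
  have hW : UpSet W := fun ω ω' h hle =>
    ⟨RdS_mono Z₁ hle h.1, fun hb => h.2.1 (MgS_anti Z₁ hle hb), fun hb => h.2.2 (MgS_anti Z₁ hle hb)⟩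
  have hC : ∀ ω, (rsig Z₁ u u' a₁ (fun _ => EStat.free) ω = (false, true, false) ∧
      bsig Z₁ u u' a₁ (fun _ => EStat.free) ω = (false, false, true)) → W ω ∧ Z₁.Mg u u' ω ∧ ¬ Z₁.Rd u u' ω := by
    intro ω ⟨hr, hb⟩
    rw [rsig_eq_iff] at hr
    rw [bsig_eq_iff] at hb
    simp only [iff_true, Bool.false_eq_true, iff_false] at hr hb
    refine ⟨⟨hr.2.1, hb.2.1, hb.1⟩, ?_, ?_⟩
    · exact (MgS_free Z₁ ω u u').1 hb.2.2
    · exact fun h => hr.2.2 ((RdS_free Z₁ ω u u').2 h)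
  have hT : ∀ ω, W ω → Z₁.Rd u u' ω → ¬ Z₁.Mg u u' ω → TopBot Z₁ a₁ u u' ω := by
    intro ω ⟨h1, h2, h3⟩ hR hM
    unfold TopBot
    rw [rsig_eq_iff, bsig_eq_iff]
    simp only [iff_true, Bool.false_eq_true, iff_false]
    have hR' := (RdS_free Z₁ ω u u').2 hR
    have hM' : ¬ MgS Z₁ (fun _ => EStat.free) ω u u' := fun h => hM ((MgS_free Z₁ ω u u').1 h)
    exact ⟨⟨RdS_trans' Z₁ h1 (RdS_symm' Z₁ hR'), h1, hR'⟩, h3, h2, hM'⟩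
  have h := class_le_of_shape Z₁ u u' a₁ u u' _ W hW hC hT hV
  convert h

open Classical in
/-- **THE CLASS `(s₃,s₁)` IS DOMINATED**: `#{V ∧ (s₃,s₁)} ≤ #{V ∧ (⊤,⊥)}` on every up-set `V`. -/
theorem class31_le_topBot {V : (E₁ → Bool) → Prop} (hV : UpSet V) :
    (univ.filter fun ω : E₁ → Bool => V ω ∧ (rsig Z₁ u u' a₁ (fun _ => EStat.free) ω = (false, false, true) ∧
      bsig Z₁ u u' a₁ (fun _ => EStat.free) ω = (true, false, false))).card ≤
      (univ.filter fun ω : E₁ → Bool => V ω ∧ TopBot Z₁ a₁ u u' ω).card := by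
  let W : (E₁ → Bool) → Prop := fun ω => RdS Z₁ (fun _ => EStat.free) ω u u' ∧
    ¬ MgS Z₁ (fun _ => EStat.free) ω u u' ∧ ¬ MgS Z₁ (fun _ => EStat.free) ω a₁ u'
  have hW : UpSet W := fun ω ω' h hle =>
    ⟨RdS_mono Z₁ hle h.1, fun hb => h.2.1 (MgS_anti Z₁ hle hb), fun hb => h.2.2 (MgS_anti Z₁ hle hb)⟩
  have hC : ∀ ω, (rsig Z₁ u u' a₁ (fun _ => EStat.free) ω = (false, false, true) ∧
      bsig Z₁ u u' a₁ (fun _ => EStat.free) ω = (true, false, false)) → W ω ∧ Z₁.Mg a₁ u ω ∧ ¬ Z₁.Rd a₁ u ω := by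
    intro ω ⟨hr, hb⟩
    rw [rsig_eq_iff] at hr
    rw [bsig_eq_iff] at hb
    simp only [iff_true, Bool.false_eq_true, iff_false] at hr hb
    refine ⟨⟨hr.2.2, hb.2.2, hb.2.1⟩, ?_, ?_⟩
    · exact (MgS_free Z₁ ω a₁ u).1 hb.1
    · exact fun h => hr.1 ((RdS_free Z₁ ω a₁ u).2 h)
  have hT : ∀ ω, W ω → Z₁.Rd a₁ u ω → ¬ Z₁.Mg a₁ u ω → TopBot Z₁ a₁ u u' ω := by
    intro ω ⟨h1, h2, h3⟩ hR hM
    unfold TopBot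
    rw [rsig_eq_iff, bsig_eq_iff]
    simp only [iff_true, Bool.false_eq_true, iff_false]
    have hR' := (RdS_free Z₁ ω a₁ u).2 hR
    have hM' : ¬ MgS Z₁ (fun _ => EStat.free) ω a₁ u := fun h => hM ((MgS_free Z₁ ω a₁ u).1 h)
    exact ⟨⟨hR', RdS_trans' Z₁ hR' h1, h1⟩, hM', h3, h2⟩
  have h := class_le_of_shape Z₁ u u' a₁ a₁ u _ W hW hC hT hV
  convert h

end MultiExit

end ZoneZ

end PercRepro
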